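import Summits.BirchSwinnertonDyer.BirchSwinnertonDyer.Theorems.ThetaPartnerAtTwoSignedKatoUpToAtTwoIwasawaInvolutionCompat
import Literature.NumberTheory.EllipticCurves.Kato2004.EulerSystemBoundFineSelmerTwo
import HarnessLib

/-!
# Route `ThetaPartnerAtTwo` (TP2), crux K3 `SignedKatoDivisibilityUpToAtTwo` (item stmt-BirchSwinnertonDyer-20308),
# line `colemanrat` v5 — THE TWO PRINT-EXACT SPELLINGS OF KATO Thm. 13.4 (2) AT `p = 2` ARE EQUIVALENT:
# «contragredient fine dual, same prime» (K2′) ⟺ «tree fine dual, prime `ι𝔭` on the `𝐇¹` side» (K2^ι = stub `stub_katoBoundTwoInv`)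

Width seat `bsd-wall-tp2-p2x-w3` g3 (cell `bsd-wall`). HONEST FRAMING: THEOREMS ONLY — no definition, no named fact, no
instance, no `sorry`; route-independent (no `Theses`/`Cruxes` import: the two statements are written out verbatim); closes no
item; Kato's theorem itself is NOT proved here (both sides are hypotheses); BSD is NOT proved by any of this.

## Why this file

The K3 lead's CONVENTION AUDIT (`Cruxes/SignedKatoDivisibilityUpToAtTwo/G4-CONVENTION-AUDIT.md`, second reader
`W3G2-READER-G4-AUDIT.md`) found that the tree's named fact
`Kato2004.thm13_4_two_lengthAt_fineSelmerDual_le_of_isEulerSystemClassTwo` compares, AT THE SAME PRIME `𝔭`, the local length of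
a fine dual datum `FB : W.FineSelmerDualData κ γ` (whose `Λ`-action is PRE-composition by `conj_γ` = print's contragredient
`X₀` twisted by the involution `ι`) with that of `I.H ⧸ Λs` for `I : Kato2004.IwasawaH1Data W 2 κ γ` (COVARIANT = print's `𝐇¹`):
this is «Kato ∘ ι» on one side, not the printed inequality. Two print-exact spellings were put forward:
* (K2′) [reader / route pen `bsd-wall-p2` g15, 02:17:45Z: «print-exact retype = `Y : FineSelmerDualData κ γ⁻¹` against
  `I : IwasawaH1Data W 2 κ γ`»]: the contragredient fine dual at the SAME prime;
* (K2^ι) [K3 lead, registered stub `stub_katoBoundTwoInv` of `Lines/colemanrat.lean` v5]: the tree's fine dual `Y : … κ γ` at `𝔭`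
  against `I.H ⧸ Λs` at `ι𝔭 = PrimeSpectrum.comap (IwasawaAlgebra.invol 2).toRingHom 𝔭`.
This file PROVES (K2′) ⟺ (K2^ι) in the kernel (`katoBoundTwoInv_of_contra`, `contra_of_katoBoundTwoInv`), by the `γ ↦ γ⁻¹`
twist of fine dual data (`IwasawaInvolution.exists_twist_fineSelmerDualData_invol`: `ℓ_{ι𝔓}(Y.X) = ℓ_𝔓(Y′.X)`) and the prime
bookkeeping `ι(ι𝔭) = 𝔭`, `ht(ι𝔭) = ht 𝔭`, `2 ∈ ι𝔭 ↔ 2 ∈ 𝔭` (`…IwasawaInvolutionCompat`). CONSEQUENCE for the planners/typers: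
whichever spelling the print-exact Literature retype of Kato 13.4 (2) at `2` takes, the registered stub `stub_katoBoundTwoInv`
(= (K2^ι) verbatim, with `IsEulerSystemClassTwo` unfolded) follows by a one-liner (`katoBoundTwoInv_of_contra` for (K2′)).
What is NOT claimed: any relation between the CURRENT tree fact (same `γ`, same `𝔭` on both sides) and either print-exact
spelling — they differ by an unprinted `ι`-symmetry of `char(𝐇¹/Λs)` (audit §1).

References: [Kato2004Asterisque, Thm. 13.4 (2) (p. 226), §13.1, Ex. 13.3]; [GreenbergLNM1716, §1 p. 60 (`X^ι`)];
[Kobayashi2003, Def. 1.1]; [PerrinRiou1994, §1.3].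
-/

set_option autoImplicit false
-- the Theorems namespace of this sub repeats the summit name by design (D-0017 nested layout)
set_option linter.dupNamespace false

noncomputable section

open scoped Classical NumberField

namespace Summit.BirchSwinnertonDyer.BirchSwinnertonDyer.Theorems

namespace SignedKatoOffTwo.IwasawaInvolution

open Field IsDedekindDomain Literature.NumberTheory.GaloisRepresentations Literature.NumberTheory.EllipticCurves
  Literature.NumberTheory.EllipticCurves.Module Literature.NumberTheory.EllipticCurves.Kato2004
  Literature.NumberTheory.EllipticCurves.Kato2004.EulerSystemValues ZpExtension

/-- **(K2′) ⟹ (K2^ι).** From Kato 13.4 (2) at `2` in the CONTRAGREDIENT spelling (fine dual datum over `γ⁻¹`, same prime on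
both sides; `IsEulerSystemClassTwo` folded) to the registered stub `stub_katoBoundTwoInv` VERBATIM (tree fine dual over `γ`,
prime `ι𝔭` on the `𝐇¹` side; Euler-system clause unfolded). Proof: twist `Y ↦ Y′` (`γ ↦ γ⁻¹`), `ℓ_𝔭(Y.X) = ℓ_{ι𝔭}(Y′.X)`,
apply (K2′) at `ι𝔭`. [cite: Kato2004Asterisque, Thm. 13.4 (2) (p. 226)] [cite: GreenbergLNM1716, §1 p. 60] -/
theorem katoBoundTwoInv_of_contra
    (hK2 : ∀ (W : WeierstrassCurve ℚ) [W.IsElliptic], ¬ W.HasCM →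
      ∀ [ContinuousSMul ℤ_[2] (W.tateModule 2)] [Module.Free ℤ_[2] (W.tateModule 2)]
        [Module.Finite ℤ_[2] (W.tateModule 2)]
        (κ : ZpExtension ℚ 2) (γ : absoluteGaloisGroup ℚ) (hκ : κ.IsCyclotomic), κ.IsTopGenerator γ →
      ∀ (I : IwasawaH1Data W 2 κ γ) (FB : W.FineSelmerDualData κ γ⁻¹) (s : I.H),
        IsEulerSystemClassTwo W hκ I s → s ≠ 0 →
        ∀ 𝔭 : PrimeSpectrum (IwasawaAlgebra 2), 𝔭.asIdeal.height = 1 →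
          PowerSeries.C (2 : ℤ_[2]) ∉ 𝔭.asIdeal →
            lengthAt (IwasawaAlgebra 2) FB.X 𝔭 ≤
              lengthAt (IwasawaAlgebra 2) (I.H ⧸ Submodule.span (IwasawaAlgebra 2) {s}) 𝔭) :
    ∀ (W : WeierstrassCurve ℚ) [W.IsElliptic], ¬ W.HasCM →
      ∀ [ContinuousSMul ℤ_[2] (W.tateModule 2)] [Module.Free ℤ_[2] (W.tateModule 2)]
        [Module.Finite ℤ_[2] (W.tateModule 2)]
        (κ : ZpExtension ℚ 2) (γ : Field.absoluteGaloisGroup ℚ) (hκ : κ.IsCyclotomic), κ.IsTopGenerator γ →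
      ∀ (I : Kato2004.IwasawaH1Data W 2 κ γ) (Y : W.FineSelmerDualData κ γ) (s : I.H),
        (∃ (S : Set (HeightOneSpectrum (𝓞 ℚ))) (_ : S.Finite)
            (z : ∀ (k : ℕ) (r : (cyclotomicLevelsRat 2 S).Ideals),
              H1 (tateRep W 2) ((cyclotomicLevelsRat 2 S).level k r.1)),
            IsEulerSystem (cyclotomicLevelsRat 2 S) (tateRep W 2) 2 z ∧
            (∀ (k : ℕ) (r : (cyclotomicLevelsRat 2 S).Ideals),
              z k r ∈ integralH1 (tateRep W 2) 2 ((cyclotomicLevelsRat 2 S).level k r.1)) ∧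
            ∀ n : ℕ, I.proj n s =
              Kato2004.levelToLayerTwo W hκ S n (z (n + 2) (cyclotomicLevelsRat 2 S).idealOne)) →
        s ≠ 0 →
        ∀ 𝔭 : PrimeSpectrum (IwasawaAlgebra 2), 𝔭.asIdeal.height = 1 →
          PowerSeries.C (2 : ℤ_[2]) ∉ 𝔭.asIdeal →
          lengthAt (IwasawaAlgebra 2) Y.X 𝔭 ≤
            lengthAt (IwasawaAlgebra 2) (I.H ⧸ Submodule.span (IwasawaAlgebra 2) {s})
              (PrimeSpectrum.comap (IwasawaAlgebra.invol 2).toRingHom 𝔭) := by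
  intro W _ hcm _ _ _ κ γ hκ hγ I Y s hES hs0 𝔭 h𝔭 h2
  obtain ⟨Y', e, -, -, -, -, hlen⟩ :=
    exists_twist_fineSelmerDualData_invol (p := 2) (mul_inv_cancel γ) Y
  set 𝔓 := PrimeSpectrum.comap (IwasawaAlgebra.invol 2).toRingHom 𝔭 with h𝔓
  have h𝔭𝔓 : PrimeSpectrum.comap (IwasawaAlgebra.invol 2).toRingHom 𝔓 = 𝔭 := comap_invol_comap_invol 2 𝔭
  have hES' : IsEulerSystemClassTwo W hκ I s := (isEulerSystemClassTwo_iff W hκ I s).2 hES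
  calc lengthAt (IwasawaAlgebra 2) Y.X 𝔭
      = lengthAt (IwasawaAlgebra 2) Y.X (PrimeSpectrum.comap (IwasawaAlgebra.invol 2).toRingHom 𝔓) := by
        rw [h𝔭𝔓]
    _ = lengthAt (IwasawaAlgebra 2) Y'.X 𝔓 := hlen 𝔓
    _ ≤ lengthAt (IwasawaAlgebra 2) (I.H ⧸ Submodule.span (IwasawaAlgebra 2) {s}) 𝔓 :=
        hK2 W hcm κ γ hκ hγ I Y' s hES' hs0 𝔓 (by rw [h𝔓, height_comap_invol, h𝔭])
          (by rw [h𝔓, C_mem_comap_invol_iff]; exact h2)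

/-- **(K2^ι) ⟹ (K2′).** The converse: from the registered stub's spelling to the contragredient one (twist `Y′ ↦ Y″`,
`γ⁻¹ ↦ γ`, and read (K2^ι) at `ι𝔭`, using `ι(ι𝔭) = 𝔭`). [cite: Kato2004Asterisque, Thm. 13.4 (2) (p. 226)]
[cite: GreenbergLNM1716, §1 p. 60] -/
theorem contra_of_katoBoundTwoInv
    (hK2ι : ∀ (W : WeierstrassCurve ℚ) [W.IsElliptic], ¬ W.HasCM →
      ∀ [ContinuousSMul ℤ_[2] (W.tateModule 2)] [Module.Free ℤ_[2] (W.tateModule 2)]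
        [Module.Finite ℤ_[2] (W.tateModule 2)]
        (κ : ZpExtension ℚ 2) (γ : Field.absoluteGaloisGroup ℚ) (hκ : κ.IsCyclotomic), κ.IsTopGenerator γ →
      ∀ (I : Kato2004.IwasawaH1Data W 2 κ γ) (Y : W.FineSelmerDualData κ γ) (s : I.H),
        (∃ (S : Set (HeightOneSpectrum (𝓞 ℚ))) (_ : S.Finite)
            (z : ∀ (k : ℕ) (r : (cyclotomicLevelsRat 2 S).Ideals),
              H1 (tateRep W 2) ((cyclotomicLevelsRat 2 S).level k r.1)),
            IsEulerSystem (cyclotomicLevelsRat 2 S) (tateRep W 2) 2 z ∧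
            (∀ (k : ℕ) (r : (cyclotomicLevelsRat 2 S).Ideals),
              z k r ∈ integralH1 (tateRep W 2) 2 ((cyclotomicLevelsRat 2 S).level k r.1)) ∧
            ∀ n : ℕ, I.proj n s =
              Kato2004.levelToLayerTwo W hκ S n (z (n + 2) (cyclotomicLevelsRat 2 S).idealOne)) →
        s ≠ 0 →
        ∀ 𝔭 : PrimeSpectrum (IwasawaAlgebra 2), 𝔭.asIdeal.height = 1 →
          PowerSeries.C (2 : ℤ_[2]) ∉ 𝔭.asIdeal →
          lengthAt (IwasawaAlgebra 2) Y.X 𝔭 ≤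
            lengthAt (IwasawaAlgebra 2) (I.H ⧸ Submodule.span (IwasawaAlgebra 2) {s})
              (PrimeSpectrum.comap (IwasawaAlgebra.invol 2).toRingHom 𝔭)) :
    ∀ (W : WeierstrassCurve ℚ) [W.IsElliptic], ¬ W.HasCM →
      ∀ [ContinuousSMul ℤ_[2] (W.tateModule 2)] [Module.Free ℤ_[2] (W.tateModule 2)]
        [Module.Finite ℤ_[2] (W.tateModule 2)]
        (κ : ZpExtension ℚ 2) (γ : absoluteGaloisGroup ℚ) (hκ : κ.IsCyclotomic), κ.IsTopGenerator γ →
      ∀ (I : IwasawaH1Data W 2 κ γ) (FB : W.FineSelmerDualData κ γ⁻¹) (s : I.H),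
        IsEulerSystemClassTwo W hκ I s → s ≠ 0 →
        ∀ 𝔭 : PrimeSpectrum (IwasawaAlgebra 2), 𝔭.asIdeal.height = 1 →
          PowerSeries.C (2 : ℤ_[2]) ∉ 𝔭.asIdeal →
            lengthAt (IwasawaAlgebra 2) FB.X 𝔭 ≤
              lengthAt (IwasawaAlgebra 2) (I.H ⧸ Submodule.span (IwasawaAlgebra 2) {s}) 𝔭 := by
  intro W _ hcm _ _ _ κ γ hκ hγ I FB s hES hs0 𝔭 h𝔭 h2
  obtain ⟨Y, e, -, -, -, -, hlen⟩ :=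
    exists_twist_fineSelmerDualData_invol (p := 2) (inv_mul_cancel γ) FB
  set 𝔓 := PrimeSpectrum.comap (IwasawaAlgebra.invol 2).toRingHom 𝔭 with h𝔓
  have h𝔭𝔓 : PrimeSpectrum.comap (IwasawaAlgebra.invol 2).toRingHom 𝔓 = 𝔭 := comap_invol_comap_invol 2 𝔭
  have hES' := (isEulerSystemClassTwo_iff W hκ I s).1 hES
  calc lengthAt (IwasawaAlgebra 2) FB.X 𝔭
      = lengthAt (IwasawaAlgebra 2) FB.X (PrimeSpectrum.comap (IwasawaAlgebra.invol 2).toRingHom 𝔓) := by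
        rw [h𝔭𝔓]
    _ = lengthAt (IwasawaAlgebra 2) Y.X 𝔓 := hlen 𝔓
    _ ≤ lengthAt (IwasawaAlgebra 2) (I.H ⧸ Submodule.span (IwasawaAlgebra 2) {s})
          (PrimeSpectrum.comap (IwasawaAlgebra.invol 2).toRingHom 𝔓) :=
        hK2ι W hcm κ γ hκ hγ I Y s hES' hs0 𝔓 (by rw [h𝔓, height_comap_invol, h𝔭])
          (by rw [h𝔓, C_mem_comap_invol_iff]; exact h2)
    _ = lengthAt (IwasawaAlgebra 2) (I.H ⧸ Submodule.span (IwasawaAlgebra 2) {s}) 𝔭 := by rw [h𝔭𝔓]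

end SignedKatoOffTwo.IwasawaInvolution

end Summit.BirchSwinnertonDyer.BirchSwinnertonDyer.Theorems

end
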